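import Literature.FieldTheory.FunctionField.RationalPolynomialFixingGroup
import Literature.FieldTheory.FunctionField.RationalAffineChains
import Mathlib.Algebra.Polynomial.Taylor
import Mathlib.RingTheory.IntegralDomain
import HarnessLib

/-!
# The fixing group of a TAME polynomial is cyclic: the multiplier homomorphism `G(F) → Kˣ`, `σ ↦ a_σ`
# (`σ(u) = a_σu + b_σ`), is injective when `char K ∤ deg F`, with image in `μ_{deg F}(K)`
# (Gutierrez–Sevilla 2008, §2 «tame», §3 Thm 9 (iii); Gutierrez–Sevilla 2006, Lemma 23)

Topic `Literature/FieldTheory/FunctionField`; namespace `Literature.FieldTheory.FunctionField`.  THEOREMS ONLY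
(no definition, no named fact, no instance, no notation; net Literature debt 0).  Sequel BY IMPORT of
`RationalPolynomialFixingGroup` (`exists_affine_comp_eq_of_mem_fixingSubgroup_adjoin_algebraMap`: every `σ ∈ G(F)` is
`u ↦ au + b` with `F ∘ (au + b) = F`, `a^{deg F} = 1`), `RationalAffineChains` (`algEquiv_mul_apply_X_affine`, the
composition law of affine substitutions), `RationalAffineFixingGroup` (`algebraMap_affine_eq_iff`), `RationalFixingGroup`
(`algEquiv_ext_of_apply_X_eq`, `finite_fixingSubgroup_adjoin`) and Mathlib (`taylor_coeff`, `hasseDeriv_coeff`,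
`isCyclic_of_injective_ringHom`, `Subgroup.card_dvd_of_injective`) — REUSED, nothing restated.

## Sources, VERBATIM

J. Gutierrez, D. Sevilla [GutierrezSevilla2008] (held `paper:arxiv-0804.1687`), §2 (p0004): «`f ∈ K[x]` is tame when
`char K` does not divide `deg f`.»; §3 Theorem 9: «Let `f ∈ K(x)` of degree `m` in normal form and `u = (ax + b)/(cx + d)`
such that `f ∘ u = f`. […] (iii) If `c = 0` (that is, we take `u = ax + b`), then `f_N(b) = 0` and `a^m = 1`.»; the
algorithm after Theorem 9: «B. Compute `A = {α ∈ K : α^m = 1}` […] C. For each `(α, β) ∈ A × B`, check if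
`f̄(αx + β) = f̄(x)`.»
J. Gutierrez, D. Sevilla [GutierrezSevilla2006] (held `paper:arxiv-0803.3976`), §3 Definition 15 «`Γ₀ = Γ ∩ K[x] =
{ax + b : a ∈ K*, b ∈ K}`», Definition 22 «`H₀ = {x + b : b ∈ F_q}`», Lemma 23 «`Γ₀` is the semidirect product of `H₀`
and `{ax : a ∈ F_q^*}`» (the projection `ax + b ↦ a` is a homomorphism with kernel the translations).

## What is proved (`K` ANY field; `Γ = RatFunc K ≃ₐ[K] RatFunc K`, `G(F) = (K(F)).fixingSubgroup`, `u = RatFunc.X`)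

* `coeff_comp_X_add_C_of_natDegree_eq_succ` (the coefficient of `x^k` in `F(x + b)`, `deg F = k + 1`, is
  `a_k + (k+1)a_{k+1}b` — Taylor / Hasse derivative), **`eq_zero_of_comp_X_add_C_eq_of_tame`** (a TAME polynomial has
  no translation symmetry: `F(x + b) = F(x) ⟹ b = 0`);
* **`exists_monoidHom_fixingSubgroup_adjoin_algebraMap`** — for non-constant `F ∈ K[u]`, the MULTIPLIER HOMOMORPHISM
  `φ : G(F) →* Kˣ` with `σ(u) = φ(σ)·u + b_σ` (Lemma 23's projection `Γ₀ → {ax}` restricted to `G(F) ≤ Γ₀`),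
  `φ(σ)^{deg F} = 1` (Theorem 9 (iii)), and `φ` INJECTIVE when `F` is tame (its kernel consists of translations);
* **`isCyclic_fixingSubgroup_adjoin_algebraMap_of_tame`** — `G(F)` is cyclic for tame `F` (a finite subgroup of `Kˣ`);
* **`card_fixingSubgroup_adjoin_algebraMap_dvd_card_rootsOfUnity`** — for tame `F` of degree `m`, `|G(F)|` divides
  `|μ_m(K)|` (so e.g. `|G(F)| ≤ 2` for every tame `F` over `ℚ` or any field with few roots of unity);
* §2 (sequel) `dvd_of_coeff_ne_zero_of_comp_C_mul_X_eq`, `eq_C_mul_X_pow_add_C_of_comp_C_mul_X_eq` (`F(ζx) = F(x)` for a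
  primitive `d`-th root `ζ` ⟹ `F ∈ K[x^d]`; `d = deg F` ⟹ `F = ax^d + e`) and
  **`exists_eq_C_mul_X_sub_C_pow_of_isGalois_of_tame`** — GALOIS TAME POLYNOMIAL EXTENSIONS ARE KUMMER: `F` tame and
  `K(u)/K(F)` Galois ⟹ `K ∋` a primitive `deg F`-th root of unity and `F = a(u − c)^{deg F} + e` (Thm 14 (ii) +
  Thm 9 (iii) + §1).  [GutierrezSevilla2006] §2 Theorem 14 (ii), verbatim: «`|G(f)| = deg f ⟹ K(f) ⊆ K(x)` is normal.
  Moreover, if the extension `K(f) ⊆ K(x)` is separable, then `K(f) ⊆ K(x)` is normal `⟹ |G(f)| = deg f`.»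
-/

noncomputable section

open Polynomial IntermediateField

namespace Literature.FieldTheory.FunctionField

variable {K : Type*} [Field K]

/-- The coefficient of `x^k` in `F(x + b)`, for `deg F = k + 1`, is `a_k + (k + 1)·a_{k+1}·b` (Taylor expansion: it is
the Hasse derivative `F^{[k]}(b)`). [cite: GutierrezSevilla2008, §3 Thm 9 (iii) (proof method: coefficients of f ∘ u)] -/
theorem coeff_comp_X_add_C_of_natDegree_eq_succ {F : K[X]} {k : ℕ} (hF : F.natDegree = k + 1) (b : K) :
    (F.comp (X + C b)).coeff k = F.coeff k + (k + 1) * F.leadingCoeff * b := by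
  rw [← taylor_apply, taylor_coeff]
  have hle : (hasseDeriv k F).natDegree ≤ 1 := by
    refine (natDegree_hasseDeriv_le F _).trans ?_
    omega
  rw [eq_X_add_C_of_natDegree_le_one hle, eval_add, eval_mul, eval_C, eval_X, eval_C, hasseDeriv_coeff,
    hasseDeriv_coeff, zero_add, Nat.choose_self, Nat.cast_one, one_mul, add_comm 1 k, Nat.choose_succ_self_right,
    leadingCoeff, hF]
  push_cast
  ring

/-- **A tame polynomial has no translation symmetry**: if `char K ∤ deg F` («tame») and `F(x + b) = F(x)` then
`b = 0` (compare the coefficients of `x^{deg F − 1}`: `deg F · lc F · b = 0`).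
[cite: GutierrezSevilla2008, §2 (tame polynomials), §3 Thm 9 (iii)] -/
theorem eq_zero_of_comp_X_add_C_eq_of_tame {F : K[X]} (htame : (F.natDegree : K) ≠ 0) {b : K}
    (h : F.comp (X + C b) = F) : b = 0 := by
  have hF : F.natDegree ≠ 0 := fun h0 => htame (by rw [h0, Nat.cast_zero])
  obtain ⟨k, hk⟩ := Nat.exists_eq_succ_of_ne_zero hF
  have hc := congrArg (fun P => P.coeff k) h
  rw [coeff_comp_X_add_C_of_natDegree_eq_succ hk, add_eq_left, mul_eq_zero, mul_eq_zero] at hc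
  rcases hc with (hc | hc) | hc
  · exact absurd (by rw [hk]; exact_mod_cast hc) htame
  · exact absurd hc (leadingCoeff_ne_zero.mpr fun h0 => hF (by rw [h0, natDegree_zero]))
  · exact hc

/-- **The multiplier homomorphism** `φ : G(F) → Kˣ`, `σ ↦ a_σ` where `σ(u) = a_σu + b_σ` (`F ∈ K[u]` non-constant;
`G(F) ≤ Γ₀` by `RationalPolynomialFixingGroup`, and `ax + b ↦ a` is the projection of Lemma 23's semidirect product
`Γ₀ = H₀ ⋊ {ax}`): a homomorphism with `φ(σ)^{deg F} = 1` («`a^m = 1`», Theorem 9 (iii)), INJECTIVE when `F` is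
tame (its kernel consists of the translations in `G(F)`, trivial by `eq_zero_of_comp_X_add_C_eq_of_tame`).
[cite: GutierrezSevilla2008, §3 Thm 9 (iii)] [cite: GutierrezSevilla2006, §3 Lemma 23] -/
theorem exists_monoidHom_fixingSubgroup_adjoin_algebraMap {F : K[X]} (hF : F.natDegree ≠ 0) :
    ∃ φ : (IntermediateField.adjoin K ({algebraMap K[X] (RatFunc K) F} : Set (RatFunc K))).fixingSubgroup →* Kˣ,
      (∀ σ : (IntermediateField.adjoin K ({algebraMap K[X] (RatFunc K) F} : Set (RatFunc K))).fixingSubgroup,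
        ∃ b : K, (σ : RatFunc K ≃ₐ[K] RatFunc K) RatFunc.X =
          algebraMap K[X] (RatFunc K) (C ((φ σ : Kˣ) : K) * X + C b)) ∧
      (∀ σ, (φ σ) ^ F.natDegree = 1) ∧
      ((F.natDegree : K) ≠ 0 → Function.Injective φ) := by
  have hmem : ∀ σ : (IntermediateField.adjoin K ({algebraMap K[X] (RatFunc K) F} : Set (RatFunc K))).fixingSubgroup,
      ∃ a b : K, a ≠ 0 ∧ (σ : RatFunc K ≃ₐ[K] RatFunc K) RatFunc.X = algebraMap K[X] (RatFunc K) (C a * X + C b) ∧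
        F.comp (C a * X + C b) = F ∧ a ^ F.natDegree = 1 ∧ F.eval b = F.eval 0 :=
    fun σ => exists_affine_comp_eq_of_mem_fixingSubgroup_adjoin_algebraMap hF σ.2
  choose a b ha hσ hcomp hpow _heval using hmem
  let φ : (IntermediateField.adjoin K ({algebraMap K[X] (RatFunc K) F} : Set (RatFunc K))).fixingSubgroup →* Kˣ :=
    { toFun := fun σ => Units.mk0 (a σ) (ha σ)
      map_one' := by
        apply Units.ext
        rw [Units.val_mk0, Units.val_one]
        have h1 : ((1 : (IntermediateField.adjoin K ({algebraMap K[X] (RatFunc K) F} :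
            Set (RatFunc K))).fixingSubgroup) : RatFunc K ≃ₐ[K] RatFunc K) RatFunc.X =
            algebraMap K[X] (RatFunc K) (C 1 * X + C 0) := by
          rw [map_one, one_mul, map_zero, add_zero, RatFunc.algebraMap_X]; rfl
        exact (algebraMap_affine_eq_iff.mp ((hσ 1).symm.trans h1)).1
      map_mul' := fun σ τ => by
        apply Units.ext
        rw [Units.val_mul, Units.val_mk0, Units.val_mk0, Units.val_mk0]
        have hst := algEquiv_mul_apply_X_affine (hσ σ) (hσ τ)
        rw [(algebraMap_affine_eq_iff.mp ((hσ (σ * τ)).symm.trans hst)).1, mul_comm] }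
  have hφ : ∀ σ, ((φ σ : Kˣ) : K) = a σ := fun σ => rfl
  refine ⟨φ, fun σ => ⟨b σ, by rw [hφ]; exact hσ σ⟩, fun σ => ?_, fun htame => ?_⟩
  · exact Units.ext (by rw [Units.val_pow_eq_pow_val, hφ, hpow, Units.val_one])
  · rw [injective_iff_map_eq_one]
    intro σ h1
    have ha1 : a σ = 1 := by rw [← hφ, h1, Units.val_one]
    -- `σ` is the translation `u ↦ u + b_σ`, which fixes the tame `F` only if `b_σ = 0`
    have hb : b σ = 0 := by
      apply eq_zero_of_comp_X_add_C_eq_of_tame htame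
      have h := hcomp σ
      rwa [ha1, map_one, one_mul] at h
    apply Subtype.ext
    apply algEquiv_ext_of_apply_X_eq
    rw [hσ σ, ha1, hb, map_one, one_mul, map_zero, add_zero, RatFunc.algebraMap_X]
    rfl

/-- **Tame polynomials have cyclic fixing groups**: if `char K ∤ deg F` then `G(F)` is cyclic — the multiplier
homomorphism embeds it into `Kˣ`, and finite subgroups of the multiplicative group of a field are cyclic.
[cite: GutierrezSevilla2008, §2 (tame), §3 Thm 9 (iii)] [cite: GutierrezSevilla2006, §3 Lemma 23] -/
theorem isCyclic_fixingSubgroup_adjoin_algebraMap_of_tame {F : K[X]} (htame : (F.natDegree : K) ≠ 0) :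
    IsCyclic (IntermediateField.adjoin K ({algebraMap K[X] (RatFunc K) F} : Set (RatFunc K))).fixingSubgroup := by
  have hF : F.natDegree ≠ 0 := fun h0 => htame (by rw [h0, Nat.cast_zero])
  haveI := finite_fixingSubgroup_adjoin (algebraMap_ne_C_of_natDegree_ne_zero hF)
  obtain ⟨φ, -, -, hinj⟩ := exists_monoidHom_fixingSubgroup_adjoin_algebraMap (K := K) hF
  exact isCyclic_of_injective_ringHom ((Units.coeHom K).comp φ) (Units.val_injective.comp (hinj htame))

/-- For a tame polynomial `F` of degree `m`, **`|G(F)|` divides `|μ_m(K)|`**, the number of `m`-th roots of unity in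
`K` (the multiplier map embeds `G(F)` into `μ_m(K)` — Theorem 9 (iii) «`a^m = 1`», algorithm step B
«`A = {α ∈ K : α^m = 1}`»); e.g. a tame polynomial over a field whose only roots of unity are `±1` has `|G(F)| ≤ 2`.
[cite: GutierrezSevilla2008, §3 Thm 9 (iii), algorithm step B] -/
theorem card_fixingSubgroup_adjoin_algebraMap_dvd_card_rootsOfUnity {F : K[X]} (htame : (F.natDegree : K) ≠ 0) :
    Nat.card (IntermediateField.adjoin K ({algebraMap K[X] (RatFunc K) F} : Set (RatFunc K))).fixingSubgroup ∣
      Nat.card (rootsOfUnity F.natDegree K) := by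
  have hF : F.natDegree ≠ 0 := fun h0 => htame (by rw [h0, Nat.cast_zero])
  obtain ⟨φ, -, hpow, hinj⟩ := exists_monoidHom_fixingSubgroup_adjoin_algebraMap (K := K) hF
  let ψ : (IntermediateField.adjoin K ({algebraMap K[X] (RatFunc K) F} : Set (RatFunc K))).fixingSubgroup →*
      rootsOfUnity F.natDegree K :=
    φ.codRestrict _ fun σ => (mem_rootsOfUnity _ _).mpr (hpow σ)
  refine Subgroup.card_dvd_of_injective ψ fun σ τ h => hinj htame ?_
  exact congrArg Subtype.val h

/-! ### §2 Galois tame polynomial extensions are Kummer (sequel, same seat) -/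

/-- If `F(ζx) = F(x)` for a primitive `d`-th root of unity `ζ`, then only exponents divisible by `d` occur in `F`
(`a_i ζ^i = a_i`; the same computation is inline in `PolynomialOneCriticalValue.exists_eq_expand_of_expand_eq_X_pow_mul_pow`).
[cite: GutierrezSevilla2008, §3 Thm 9 (iii), algorithm step C («check if f̄(αx + β) = f̄(x)»)] -/
theorem dvd_of_coeff_ne_zero_of_comp_C_mul_X_eq {F : K[X]} {ζ : K} {d : ℕ} (hζ : IsPrimitiveRoot ζ d)
    (h : F.comp (C ζ * X) = F) {i : ℕ} (hi : F.coeff i ≠ 0) : d ∣ i := by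
  have hc := congrArg (fun P : K[X] => P.coeff i) h
  simp only [comp_C_mul_X_coeff] at hc
  rw [← hζ.pow_eq_one_iff_dvd]
  exact mul_left_cancel₀ hi (hc.trans (mul_one _).symm)

/-- If `F(ζx) = F(x)` for a primitive `deg F`-th root of unity `ζ` (`deg F ≥ 1`), then `F = a·x^{deg F} + e`: no
exponent strictly between `0` and `deg F` is a multiple of `deg F`.
[cite: GutierrezSevilla2008, §3 Thm 9 (iii), algorithm step C] -/
theorem eq_C_mul_X_pow_add_C_of_comp_C_mul_X_eq {F : K[X]} (hF : F.natDegree ≠ 0) {ζ : K}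
    (hζ : IsPrimitiveRoot ζ F.natDegree) (h : F.comp (C ζ * X) = F) :
    F = C F.leadingCoeff * X ^ F.natDegree + C (F.coeff 0) := by
  ext i
  simp only [coeff_add, coeff_C_mul, coeff_X_pow, coeff_C, mul_ite, mul_one, mul_zero]
  by_cases h0 : i = 0
  · subst h0
    rw [if_neg (Ne.symm hF), if_pos rfl, zero_add]
  · rw [if_neg h0, add_zero]
    by_cases hm : i = F.natDegree
    · rw [if_pos hm, hm, leadingCoeff]
    · rw [if_neg hm]
      by_contra hne
      have hdvd := dvd_of_coeff_ne_zero_of_comp_C_mul_X_eq hζ h hne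
      have hle : i ≤ F.natDegree := le_natDegree_of_ne_zero hne
      rcases Nat.eq_zero_or_pos i with hi0 | hipos
      · exact h0 hi0
      · exact hm (le_antisymm hle (Nat.le_of_dvd hipos hdvd))

/-- **Galois tame polynomial extensions are Kummer.** If `F ∈ K[u]` is tame (`char K ∤ m`, `m = deg F`) and
`K(u)/K(F)` is Galois, then `K` contains a primitive `m`-th root of unity `ζ` and `F = a(u − c)^m + e` for some
`a ≠ 0, c, e ∈ K` (so `K(F) = K((u − c)^m)`).  Assembly of printed facts: Galois ⟹ `|G(F)| = deg F` (Theorem 14 (ii),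
the tree's `card_fixingSubgroup_adjoin_eq_iff_isGalois`); `G(F)` is cyclic with injective multiplier map (§1), so a
generator `σ₀ : u ↦ ζu + b` has a multiplier `ζ` of exact order `m` («`a^m = 1`», Theorem 9 (iii)); for `m ≥ 2`,
`ζ ≠ 1` and the translate `F̃(v) = F(v + c)`, `c = b/(1 − ζ)` (the fixed point of `u ↦ ζu + b`), satisfies
`F̃(ζv) = F̃(v)`, whence `F̃ = a v^m + e`.
[cite: GutierrezSevilla2006, §2 Thm 14 (ii)] [cite: GutierrezSevilla2008, §2 (tame), §3 Thm 9 (iii)] -/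
theorem exists_eq_C_mul_X_sub_C_pow_of_isGalois_of_tame {F : K[X]} (htame : (F.natDegree : K) ≠ 0)
    (hgal : IsGalois (IntermediateField.adjoin K ({algebraMap K[X] (RatFunc K) F} : Set (RatFunc K))) (RatFunc K)) :
    ∃ ζ a c e : K, IsPrimitiveRoot ζ F.natDegree ∧ a ≠ 0 ∧ F = C a * (X - C c) ^ F.natDegree + C e := by
  have hF : F.natDegree ≠ 0 := fun h0 => htame (by rw [h0, Nat.cast_zero])
  have hFC := algebraMap_ne_C_of_natDegree_ne_zero (K := K) hF
  haveI := finite_fixingSubgroup_adjoin hFC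
  -- `|G(F)| = deg F` (Galois), `G(F)` cyclic (tame); a generator has order `deg F`, and so has its multiplier
  have hcard : Nat.card (IntermediateField.adjoin K ({algebraMap K[X] (RatFunc K) F} : Set (RatFunc K))).fixingSubgroup
      = F.natDegree := by
    rw [← max_natDegree_algebraMap F]
    exact (card_fixingSubgroup_adjoin_eq_iff_isGalois hFC).mpr hgal
  haveI := isCyclic_fixingSubgroup_adjoin_algebraMap_of_tame htame
  obtain ⟨σ₀, hσ₀⟩ := IsCyclic.exists_generator
    (α := (IntermediateField.adjoin K ({algebraMap K[X] (RatFunc K) F} : Set (RatFunc K))).fixingSubgroup)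
  have hord : orderOf σ₀ = F.natDegree := (orderOf_eq_card_of_forall_mem_zpowers hσ₀).trans hcard
  obtain ⟨φ, hφ, -, hinj⟩ := exists_monoidHom_fixingSubgroup_adjoin_algebraMap (K := K) hF
  obtain ⟨b, hb⟩ := hφ σ₀
  have hζ : IsPrimitiveRoot ((φ σ₀ : Kˣ) : K) F.natDegree := by
    rw [IsPrimitiveRoot.coe_units_iff, IsPrimitiveRoot.iff_orderOf, orderOf_injective φ (hinj htame), hord]
  -- the affine symmetry `F(ζu + b) = F(u)`
  obtain ⟨a', b', -, hσ', hcomp', -, -⟩ := exists_affine_comp_eq_of_mem_fixingSubgroup_adjoin_algebraMap hF σ₀.2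
  obtain ⟨ha', hb'⟩ := algebraMap_affine_eq_iff.mp (hσ'.symm.trans hb)
  rw [ha', hb'] at hcomp'
  revert hζ hcomp'
  generalize ((φ σ₀ : Kˣ) : K) = ζ
  intro hζ hcomp'
  rcases Nat.lt_or_ge 1 F.natDegree with hm1 | hm1
  · -- `deg F ≥ 2`: `ζ ≠ 1`; translate by the fixed point `c = b/(1 − ζ)` of `u ↦ ζu + b`
    have h1ζ : (1 - ζ) ≠ 0 := sub_ne_zero.mpr (Ne.symm (hζ.ne_one hm1))
    obtain ⟨c, hc⟩ : ∃ c : K, c = b / (1 - ζ) := ⟨_, rfl⟩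
    have hcb : ζ * c + b = c := by
      rw [hc, eq_div_iff h1ζ]
      field_simp
      ring
    have hlin : (C ζ * X + C b).comp (X + C c) = C ζ * X + C c := by
      simp only [add_comp, mul_comp, C_comp, X_comp]
      conv_rhs => rw [← hcb]
      simp only [C_add, C_mul]
      ring
    have e2 : F.comp (X + C c) = F.comp (C ζ * X + C c) := by
      calc F.comp (X + C c) = (F.comp (C ζ * X + C b)).comp (X + C c) := by rw [hcomp']
        _ = F.comp ((C ζ * X + C b).comp (X + C c)) := comp_assoc _ _ _
        _ = F.comp (C ζ * X + C c) := by rw [hlin]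
    have e1 : (F.comp (X + C c)).comp (C ζ * X) = F.comp (C ζ * X + C c) := by
      rw [comp_assoc]
      congr 1
      simp only [add_comp, X_comp, C_comp]
    have hsymm : (F.comp (X + C c)).comp (C ζ * X) = F.comp (X + C c) := e1.trans e2.symm
    have hdeg : (F.comp (X + C c)).natDegree = F.natDegree := by
      rw [natDegree_comp, natDegree_X_add_C, mul_one]
    have hdeg0 : (F.comp (X + C c)).natDegree ≠ 0 := by rwa [hdeg]
    have hζ' : IsPrimitiveRoot ζ (F.comp (X + C c)).natDegree := by rwa [hdeg]
    have key := eq_C_mul_X_pow_add_C_of_comp_C_mul_X_eq hdeg0 hζ' hsymm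
    rw [hdeg] at key
    have hback : F = (F.comp (X + C c)).comp (X - C c) := by
      rw [comp_assoc]
      simp only [add_comp, X_comp, C_comp, sub_add_cancel, comp_X]
    refine ⟨ζ, (F.comp (X + C c)).leadingCoeff, c, (F.comp (X + C c)).coeff 0, hζ,
      leadingCoeff_ne_zero.mpr (fun h0 => hdeg0 (by rw [h0, natDegree_zero])), ?_⟩
    calc F = (F.comp (X + C c)).comp (X - C c) := hback
      _ = (C (F.comp (X + C c)).leadingCoeff * X ^ F.natDegree + C ((F.comp (X + C c)).coeff 0)).comp
            (X - C c) := by rw [← key]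
      _ = _ := by simp only [add_comp, mul_comp, C_comp, X_pow_comp]
  · -- `deg F = 1`
    have hdeg1 : F.natDegree = 1 := le_antisymm hm1 (Nat.one_le_iff_ne_zero.mpr hF)
    refine ⟨ζ, F.leadingCoeff, 0, F.coeff 0, hζ,
      leadingCoeff_ne_zero.mpr (fun h0 => hF (by rw [h0, natDegree_zero])), ?_⟩
    have hlc : F.leadingCoeff = F.coeff 1 := by rw [leadingCoeff, hdeg1]
    rw [hlc, map_zero, sub_zero, hdeg1, pow_one]
    exact eq_X_add_C_of_natDegree_le_one hm1

end Literature.FieldTheory.FunctionField
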